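import Literature.Analysis.ODE.TorusFlowJacobian
import Literature.Analysis.FunctionSpaces.TorusDerivBounds
import HarnessLib

/-!
# Higher space derivatives along the flow of a vector field on the torus: the time derivative of
# `∂^l D` and Grönwall's inequality with a time-dependent forcing

Analysis/ODE proof file (theorems only; no definitions, no named facts). Two generic inputs of the
inductive proof of Armstrong–Vicol's flow estimate (App. A Prop. 7.11, arXiv:2305.05048 pp. 73–74) for
the flow `X = id + proj∘D` of a jointly smooth field `f` (`D(0,·) = 0`, `∂ₜD(t,x) = f(t, X(t,x))`):

* `hasDerivAt_iterPartialDeriv_disp` — **differentiating the flow equation in space**: for every word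
  `l` and component `i`, `∂ₜ ∂^l Dᵢ(t,x) = ∂^l [fᵢ(t, X(t,·))](x)` (time and space derivatives of jointly
  smooth fields commute; the printed "(eq:chain:rule:steroids)" before expanding the right side);
* `norm_le_exp_mul_integral_of_norm_deriv_le` — **Grönwall with forcing**: a curve `y` in a normed
  space with `y(0) = 0` and `‖y'(t)‖ ≤ K‖y(t)‖ + ε(t)` on `[0,T)` (`K ≥ 0`, `ε ≥ 0` continuous) obeys
  `‖y(t)‖ ≤ e^{Kt} ∫₀ᵗ ε` on `[0,T]` (the fencing theorem
  `image_norm_le_of_norm_deriv_right_lt_deriv_boundary` with the barrier `e^{Kt}(∫₀ᵗε + η(t+1))`, `η ↓ 0`) —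
  the printed step "`‖∂^β X(t)‖ ≤ exp(T‖∇f‖) ∫₀ᵗ |E_old(s)| ds`".

## References

* S. Armstrong, V. Vicol, *Anomalous diffusion by fractal homogenization*, Ann. PDE 11 (2025),
  arXiv:2305.05048, App. A Prop. 7.11 (proof, pp. 73–74). [`ArmstrongVicol2025`]
* P. Hartman, *Ordinary Differential Equations* (2nd ed., SIAM 2002), Ch. III Thm 1.1 (Grönwall) and
  Ch. V Thm 3.1 (differentiability of solutions in parameters). [`Hartman2002`]
-/

noncomputable section

open Set Function Filter MeasureTheory
open scoped Topology

namespace Literature.Analysis.ODE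

namespace TorusFlow

open Literature.Analysis.FunctionSpaces Literature.Analysis.FunctionSpaces.Torus

variable {d : Type*} [Fintype d] [DecidableEq d]

/-! ## §1 `∂ₜ ∂^l D = ∂^l (f ∘ X)` -/

section TimeSpace

variable {F : Type*} [NormedAddCommGroup F] [NormedSpace ℝ F]

/-- `∂ₜ` commutes with `∂^l` within `[a,b]` for jointly smooth fields (iterate the tree's
`timeDerivWithin_partialDeriv_comm`). [folklore] -/
private theorem timeDerivWithin_iterPartialDeriv_comm' {a b : ℝ} (hab : a < b) {u : ℝ → UnitAddTorus d → F}
    (hu : IsSmoothSpaceTimeOn (Icc a b) u) {t : ℝ} (ht : t ∈ Icc a b) :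
    ∀ (l : List d) (x : UnitAddTorus d),
      timeDerivWithin (Icc a b) (fun s => iterPartialDeriv l (u s)) t x =
        iterPartialDeriv l (timeDerivWithin (Icc a b) u t) x
  | [], _ => rfl
  | i :: l, x => by
    have hS : UniqueDiffOn ℝ (Icc a b) := uniqueDiffOn_Icc hab
    have hU : IsSmoothSpaceTimeOn (Icc a b) (fun s => iterPartialDeriv l (u s)) := hu.iterPartialDeriv hS l
    have h1 := timeDerivWithin_partialDeriv_comm hab hU ht i x
    simp only [iterPartialDeriv_cons]
    rw [h1]
    have h2 : timeDerivWithin (Icc a b) (fun s => iterPartialDeriv l (u s)) t =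
        iterPartialDeriv l (timeDerivWithin (Icc a b) u t) :=
      funext fun y => timeDerivWithin_iterPartialDeriv_comm' hab hu ht l y
    rw [h2]

end TimeSpace

variable {f D : ℝ → UnitAddTorus d → EuclideanSpace ℝ d}

omit [DecidableEq d] in
/-- Components of the displacement ODE: `∂ₜ Dᵢ(t, x) = fᵢ(t, X(t,x))`. [folklore] -/
private theorem hasDerivAt_disp_apply'
    (hODE : ∀ t x, HasDerivAt (fun s => D s x) (f t (x + proj (D t x))) t) (i : d) (t : ℝ)
    (x : UnitAddTorus d) : HasDerivAt (fun s => D s x i) (f t (x + proj (D t x)) i) t := by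
  have h := (hODE t x).hasFDerivAt.hasFDerivWithinAt (s := Set.univ)
  have hi := (((hasFDerivWithinAt_piLp 2).1 h) i).hasDerivWithinAt
  rw [hasDerivWithinAt_univ] at hi
  simpa using hi

/-- **Differentiating the flow equation in space**: for the flow `X = id + proj∘D` of a jointly smooth
field `f` (`∂ₜD = f ∘ X`, `D` jointly smooth), every word derivative of every component satisfies
`∂ₜ ∂^l Dᵢ(t, x) = ∂^l [y ↦ fᵢ(t, y + proj D(t,y))](x)`.
[cite: ArmstrongVicol2025, App. A Prop. 7.11 (proof, (eq:chain:rule:steroids))] -/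
theorem hasDerivAt_iterPartialDeriv_disp (hD : IsSmoothSpaceTimeOn univ D)
    (hODE : ∀ t x, HasDerivAt (fun s => D s x) (f t (x + proj (D t x))) t) (l : List d) (i : d) (t : ℝ)
    (x : UnitAddTorus d) :
    HasDerivAt (fun s => iterPartialDeriv l (fun y => D s y i) x)
      (iterPartialDeriv l (fun y => f t (y + proj (D t y)) i) x) t := by
  set a : ℝ := t - 1
  set b : ℝ := t + 1
  have hab : a < b := by simp only [a, b]; linarith
  have ht : t ∈ Icc a b := ⟨by simp only [a]; linarith, by simp only [b]; linarith⟩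
  have hDi : IsSmoothSpaceTimeOn (Icc a b) (fun s y => D s y i) := (hD.apply i).mono (subset_univ _)
  have hG : IsSmoothSpaceTimeOn (Icc a b) (fun s => iterPartialDeriv l (fun y => D s y i)) :=
    hDi.iterPartialDeriv (uniqueDiffOn_Icc hab) l
  have h1 : HasDerivAt (fun s => iterPartialDeriv l (fun y => D s y i) x)
      (timeDerivWithin (Icc a b) (fun s => iterPartialDeriv l (fun y => D s y i)) t x) t :=
    (hG.hasDerivWithinAt_slice ht x).hasDerivAt (Icc_mem_nhds (by simp only [a]; linarith) (by simp only [b]; linarith))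
  have h2 := timeDerivWithin_iterPartialDeriv_comm' hab hDi ht l x
  have h3 : timeDerivWithin (Icc a b) (fun s y => D s y i) t = fun y => f t (y + proj (D t y)) i := by
    funext y
    exact ((hasDerivAt_disp_apply' hODE i t y).hasDerivWithinAt).derivWithin (uniqueDiffOn_Icc hab t ht)
  rw [h2, h3] at h1
  exact h1

omit [Fintype d] in
/-- At time `0` all word derivatives of order `≥ 1` of the displacement vanish (`D(0,·) = 0`).
[cite: ArmstrongVicol2025, App. A Prop. 7.11 (proof: ∂^β X|_{t=0} = 0 for |β| ≥ 2)] -/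
theorem iterPartialDeriv_disp_zero (hD0 : ∀ x, D 0 x = 0) {l : List d} (hl : l ≠ []) (i : d) (x : UnitAddTorus d) :
    iterPartialDeriv l (fun y => D 0 y i) x = 0 := by
  have h : (fun y => D 0 y i) = fun _ => (0 : ℝ) := funext fun y => by rw [hD0 y]; rfl
  rw [h, iterPartialDeriv_const (0 : ℝ) l hl]
  rfl

/-! ## §2 Grönwall's inequality with a time-dependent forcing -/

/-- **Grönwall with forcing**: if `y(0) = 0`, `y` is differentiable with `‖y'(t)‖ ≤ K‖y(t)‖ + ε(t)` on
`[0,T)` (`K ≥ 0`, `ε ≥ 0` continuous), then `‖y(t)‖ ≤ e^{Kt} ∫₀ᵗ ε` for `t ∈ [0,T]`.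
[cite: Hartman2002, Ch. III Thm 1.1; ArmstrongVicol2025, App. A Prop. 7.11 (proof: Grönwall step)] -/
theorem norm_le_exp_mul_integral_of_norm_deriv_le {E : Type*} [NormedAddCommGroup E] [NormedSpace ℝ E]
    {y y' : ℝ → E} {K T : ℝ} (hK : 0 ≤ K) {ε : ℝ → ℝ} (hε : Continuous ε) (hε0 : ∀ s, 0 ≤ ε s)
    (hy : ∀ t, HasDerivAt y (y' t) t) (hy0 : y 0 = 0)
    (hb : ∀ t ∈ Ico 0 T, ‖y' t‖ ≤ K * ‖y t‖ + ε t) {t : ℝ} (ht : t ∈ Icc 0 T) :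
    ‖y t‖ ≤ Real.exp (K * t) * ∫ s in (0 : ℝ)..t, ε s := by
  set Φ : ℝ → ℝ := fun u => ∫ s in (0 : ℝ)..u, ε s with hΦ
  have hΦ' : ∀ u, HasDerivAt Φ (ε u) u := fun u => (hε.integral_hasStrictDerivAt 0 u).hasDerivAt
  -- barrier with a margin `η > 0`
  have key : ∀ η : ℝ, 0 < η → ‖y t‖ ≤ Real.exp (K * t) * (Φ t + η * (t + 1)) := by
    intro η hη
    set B : ℝ → ℝ := fun u => Real.exp (K * u) * (Φ u + η * (u + 1)) with hB
    set B' : ℝ → ℝ := fun u => K * B u + Real.exp (K * u) * (ε u + η) with hB'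
    have hBd : ∀ u, HasDerivAt B (B' u) u := by
      intro u
      have he : HasDerivAt (fun u => Real.exp (K * u)) (Real.exp (K * u) * K) u := by
        have h1 : HasDerivAt (fun u : ℝ => K * u) (K * 1) u := (hasDerivAt_id u).const_mul K
        have h := (Real.hasDerivAt_exp (K * u)).comp u h1
        rw [mul_one] at h
        exact h
      have hin : HasDerivAt (fun u => Φ u + η * (u + 1)) (ε u + η) u := by
        have h2 : HasDerivAt (fun u : ℝ => η * (u + 1)) η u := by
          simpa using ((hasDerivAt_id u).add_const 1).const_mul η
        exact (hΦ' u).add h2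
      have h := he.mul hin
      refine h.congr_deriv ?_
      simp only [hB', hB]
      ring
    have hcont : ContinuousOn y (Icc 0 T) := fun u _ => (hy u).continuousAt.continuousWithinAt
    have h := image_norm_le_of_norm_deriv_right_lt_deriv_boundary (f := y) (f' := y') (a := 0) (b := T) hcont
      (fun u _ => (hy u).hasDerivWithinAt) (B := B) (B' := B') ?_ hBd ?_ ht
    · exact h
    · rw [hy0, norm_zero]
      simp only [hB, hΦ]
      simp [hη.le]
    · intro u hu hyu
      have he1 : 1 ≤ Real.exp (K * u) := Real.one_le_exp (mul_nonneg hK hu.1)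
      calc ‖y' u‖ ≤ K * ‖y u‖ + ε u := hb u hu
        _ = K * B u + ε u := by rw [hyu]
        _ < K * B u + Real.exp (K * u) * (ε u + η) := by
            have : ε u < Real.exp (K * u) * (ε u + η) := by nlinarith [hε0 u]
            linarith
  -- let `η ↓ 0`
  refine le_of_forall_pos_le_add fun δ hδ => ?_
  have hpos : 0 < Real.exp (K * t) * (t + 1) := mul_pos (Real.exp_pos _) (by linarith [ht.1])
  have h := key (δ / (Real.exp (K * t) * (t + 1))) (div_pos hδ hpos)
  have ht1 : (t + 1) ≠ 0 := by linarith [ht.1]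
  calc ‖y t‖ ≤ Real.exp (K * t) * (Φ t + δ / (Real.exp (K * t) * (t + 1)) * (t + 1)) := h
    _ = Real.exp (K * t) * Φ t + δ := by field_simp

end TorusFlow

end Literature.Analysis.ODE

end
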